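import Literature.NumberTheory.NumberFields.QuadraticSqrtTwoClassNumberDvdFourCertificate
import HarnessLib

/-!
# An ORDER-FOUR CERTIFICATE one quadratic step higher: a class of order `4` in `Cl(L)` for the tower
# `K ⊂ K₁ = K(s₁) ⊂ L = K₁(s₂)`, `s₁² = 2`, `s₂² = 2 + s₁`, from `n = rank E_L` units modulo `±` squares (residue symbols
# COMPUTED IN `𝓞_K`), an explicit ideal `𝔅 = (b, v)` with `𝔅² = (w, b²)` not principal and `𝔅⁴ = (w)`; and the
# CHARACTER-MATRIX form of the residue certificates

Topic `NumberTheory/NumberFields` (namespace = path).  THEOREM-ONLY file (no definition, no named fact, no instance, no `sorry`),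
written by the prover seat `bsd-line-att-p4` g41 (cell `bsd-f1-sign2`, route `AlignedTransportAtTwo`; `--supports`
stmt-BirchSwinnertonDyer-22298, closes nothing).  It is this seat's g40 file `QuadraticSqrtTwoClassNumberDvdFourCertificate`
(`4 ∣ h(K(√2))`: three units, `31` residue certificates) taken ONE LAYER UP the cyclotomic `ℤ₂`-tower: the field is now
`L = K(√2, √(2+√2)) = K·ℚ(ζ₁₆)⁺` (the second layer), the coordinates of an element of `L` are FOUR elements of `K` on the basis
`1, s₁, s₂, s₁s₂`, the residue symbols are evaluated at `(ψ, r₁, r₂)` with `r₁² = 2`, `r₂² = 2 + r₁` in `ℤ/q`, and the number of units is a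
parameter `n ≥ rank E_L` (for a complex cubic `K`: `n = 7`), so that the `2ⁿ⁺²−1` residue certificates are best supplied through the
CHARACTER MATRIX (§6): `m` residue characters whose `𝔽₂`-valued Euler bits on the `n + 2` generators `−1, u_1, …, u_n, w` form a matrix
with a LEFT INVERSE.

## Contents

* §1 one quadratic step `L = K(s)`, `s² = d ∈ K`: the non-trivial automorphism negates `s`; **`4·𝓞_L ⊆ 𝓞_K + 𝓞_K s` whenever `d·d' = 2`
  with `d'` integral** (`2a = Tr z`, `(2cs)² d' = 8c²`; covers `d = 2` and `d = 2 + √2`).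
* §2 the tower: four coordinates over `K`, uniqueness, the product formula, `√−1 ∉ L` when `L` is real somewhere.
* §3 **`16·𝓞_L` has coordinates in `𝓞_K`**; ★ the residue-symbol obstruction: `z² = x₀ + x₁s₁ + (x₂ + x₃s₁)s₂` (`x_i ∈ 𝓞_K`) forces
  `ψx₀ + ψx₁r₁ + (ψx₂ + ψx₃r₁)r₂` to be a square in `ℤ/q` — the quadratic character of the degree-one prime `(ker ψ, s₁ − r₁, s₂ − r₂)` of `L`
  evaluated WITHOUT constructing it; multiplicativity on signed products `±∏ x_i^{e_i} w^{e'}`.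
* §4 `#Pl_∞(L) ≤ 2·#Pl_∞(K)` for a quadratic step (so `rank E_L ≤ 4·#Pl_∞(K) − 1` over the tower).
* §5 ★★ THE CERTIFICATE: `n ≥ rank E_L` units `u_i` and `w` with `𝓞_K`-coordinates, `(b,v)² = (w,b²)`, `(w,b²)² = (w)`, `b ≠ 0`, and for every
  `(e, e', ±) ≠ (0, 0, +)` a residue certificate ⟹ **a class of order `4` in `Cl(L)`** (and `4 ∣ h_L`).  Proof = g40's: if `(w,b²) = (y)` then
  `w = u y²`, Dirichlet (`n + 1 > rank E_L` units have a non-empty sub-product `= ±□`, `√−1 ∉ L`) gives a pattern with `±∏u_i^{e_i}w^{e'}` a square,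
  contradicting its certificate.
* §6 ★ THE CHARACTER MATRIX: `m` residue characters `(q_j prime, ψ_j, r₁, r₂)` with Euler bits `g_k^{(q_j−1)/2} = (−1)^{B_{jk}}` on the generators
  `g = (−1, u_1, …, u_n, w)` and a matrix `N` over `𝔽₂` with `N·B = 1` ⟹ the `2ⁿ⁺²−1` certificates of §5 (a non-zero exponent vector `ε` has
  `Bε ≠ 0`, i.e. some character sees an odd number of non-residues: Euler's criterion).

HONEST SCOPE: textbook computational algebraic number theory (verification of class-group/unit data by independent certificates,
Cohen §6.5; quadratic characters of residue fields; Dirichlet's unit theorem); nothing specific to any summit; BSD is not advanced by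
this file.  USE (cell bsd-f1-sign2, crux C2, hard-core seeds `N = 3027, 9139` of the u7 sub-cell, `t = 3 ∧ e₁ = 1`): a class of ORDER `4` in
`Cl(K_2)`, `K_2 = ℚ(β, ζ₁₆ + ζ₁₆⁻¹)`, is the displayed input of att-p3 g47's elementary-layer door
(`IwasawaTheory.classicalMuVanishes_two_of_orderOf_eq_four_of_not_dvd_discr`: `μ₂ = 0`, `λ₂ ≤ 2`).

presearch: «certifying an ideal class of order 4 / units modulo squares via quadratic residue characters / verification of class
groups» → [corpus: cohen1993 §6.5 (verification of class group and unit computations), §4.8], [corpus: buhler2008 pp. 517–529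
(Stevenhagen)], [corpus: buell1989 pp. 78–87 (4-rank, quadratic case)]; galaxy all «class of order 4|character matrix|quadratic characters of units»:
quadratic/cyclotomic-field literature only (Rédei matrices); the relative certificate over `K(√2, √(2+√2))/K` is folklore-computational, not
found stated.  Expected REF2 placement: TEXTBOOK/COROLLARY-OF-MATHLIB.

References: [NeukirchANT1999] Ch. I §2, §3, §7 Thm. (7.4), §8; [Cohen1993] §4.8–§4.9, §6.5; [Marcus2018] Ch. 3 Thm. 27, Ch. 5;
[Serre1973CourseArithmetic] Ch. I §3 (Euler's criterion, the Legendre symbol); [Washington1997] §13.1 (`ℚ_2 = ℚ(ζ₁₆)⁺ = ℚ(√(2+√2))`).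
-/

set_option autoImplicit false

noncomputable section

open NumberField NumberField.Units Module
open scoped nonZeroDivisors

namespace Literature.NumberTheory.NumberFields

/-! ## §1 One quadratic step `L = K(s)`, `s² = d ∈ K` -/

section QuadStep

variable {K L : Type*} [Field K] [Field L] [Algebra K L]

/-- **The non-trivial automorphism of a quadratic `L = K(s)`, `s² = d ∈ K`, sends `s ↦ −s`** (`(σs)² = d = s²` and `σs = s` would
make `σ = 1` on `K ⊕ Ks`). [cite: NeukirchANT1999, Ch. I §2 (conjugates in `K(√d)`)] -/
theorem exists_algEquiv_apply_eq_neg_of_sq_eq [FiniteDimensional K L] [IsGalois K L] (h2 : Module.finrank K L = 2)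
    {s : L} {d : K} (hs : s ^ 2 = algebraMap K L d) (hsK : ∀ k : K, algebraMap K L k ≠ s) :
    ∃ σ : L ≃ₐ[K] L, σ s = -s := by
  have hcard : Fintype.card (L ≃ₐ[K] L) = 2 := by
    rw [← Nat.card_eq_fintype_card, IsGalois.card_aut_eq_finrank, h2]
  obtain ⟨σ, hσ⟩ := Fintype.exists_ne_of_one_lt_card (by rw [hcard]; norm_num) (1 : L ≃ₐ[K] L)
  refine ⟨σ, ?_⟩
  have hσs : (σ s - s) * (σ s + s) = 0 := by
    have h1 : σ s ^ 2 = algebraMap K L d := by rw [← map_pow, hs, AlgEquiv.commutes]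
    linear_combination h1 - hs
  rcases mul_eq_zero.mp hσs with h | h
  · exfalso
    apply hσ
    ext x
    obtain ⟨a, c, rfl⟩ := exists_eq_add_mul_of_finrank_eq_two h2 hsK x
    rw [map_add, map_mul, AlgEquiv.commutes, AlgEquiv.commutes, sub_eq_zero.mp h, AlgEquiv.one_apply]
  · linear_combination h

/-- **`4·𝓞_L ⊆ 𝓞_K + 𝓞_K s`** for `L = K(s)`, `s² = d` with `d·d' = 2`, `d'` integral (e.g. `d = 2`, `d' = 1`; `d = 2 + √2`, `d' = 2 − √2`):
if `z = a + cs` is integral then `2a = z + σz` and `(2cs)² = 4c²d` are integral, so `16c² = 2·d'·4c²d` is integral, `4c ∈ 𝓞_K`, and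
`4z = 2(2a) + (4c)s`. [cite: NeukirchANT1999, Ch. I §2 (integral closure; trace and norm of integral elements)] -/
theorem exists_four_mul_eq_coord_of_isIntegral_of_sq_eq [NumberField L] [FiniteDimensional K L] [IsGalois K L]
    (h2 : Module.finrank K L = 2) {s : L} {d d' : K} (hs : s ^ 2 = algebraMap K L d)
    (hsK : ∀ k : K, algebraMap K L k ≠ s) (hd' : IsIntegral ℤ d') (hdd : d * d' = 2) {z : L} (hz : IsIntegral ℤ z) :
    ∃ a₁ c₁ : 𝓞 K, 4 * z = algebraMap K L (a₁ : K) + algebraMap K L (c₁ : K) * s := by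
  obtain ⟨a, c, rfl⟩ := exists_eq_add_mul_of_finrank_eq_two h2 hsK z
  obtain ⟨σ, hσs⟩ := exists_algEquiv_apply_eq_neg_of_sq_eq h2 hs hsK
  have hσz : σ (algebraMap K L a + algebraMap K L c * s) = algebraMap K L a - algebraMap K L c * s := by
    rw [map_add, map_mul, AlgEquiv.commutes, AlgEquiv.commutes, hσs]; ring
  have hσint : IsIntegral ℤ (σ (algebraMap K L a + algebraMap K L c * s)) := map_isIntegral_int (σ : L →+* L) hz
  -- `2a ∈ 𝓞_K`
  have h2a : IsIntegral ℤ (2 * a) := by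
    have heq : (algebraMap K L a + algebraMap K L c * s) + (algebraMap K L a - algebraMap K L c * s) =
        algebraMap K L (2 * a) := by
      rw [map_mul, map_ofNat]; ring
    have hsum : IsIntegral ℤ (algebraMap K L (2 * a)) := by
      have := hz.add hσint
      rwa [hσz, heq] at this
    exact (isIntegral_algebraMap_iff (algebraMap K L).injective).mp hsum
  -- `4c ∈ 𝓞_K`
  have h4c : IsIntegral ℤ (4 * c) := by
    have heq : (algebraMap K L a + algebraMap K L c * s) - (algebraMap K L a - algebraMap K L c * s) =
        algebraMap K L (2 * c) * s := by
      rw [map_mul, map_ofNat]; ring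
    have hdiff : IsIntegral ℤ (algebraMap K L (2 * c) * s) := by
      have := hz.sub hσint
      rwa [hσz, heq] at this
    have heq2 : (algebraMap K L (2 * c) * s) * (algebraMap K L (2 * c) * s) * algebraMap K L (2 * d') =
        algebraMap K L (16 * c ^ 2) := by
      have hdd' : algebraMap K L d * algebraMap K L d' = 2 := by rw [← map_mul, hdd, map_ofNat]
      simp only [map_mul, map_pow, map_ofNat]
      linear_combination ((8 : L) * (algebraMap K L c) ^ 2 * algebraMap K L d') * hs +
        ((8 : L) * (algebraMap K L c) ^ 2) * hdd'
    have h2d' : IsIntegral ℤ (algebraMap K L (2 * d')) := by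
      rw [map_mul, map_ofNat]
      have h2 : IsIntegral ℤ (2 : L) := by
        have := isIntegral_algebraMap (R := ℤ) (A := L) (x := (2 : ℤ))
        rwa [map_ofNat] at this
      exact h2.mul ((isIntegral_algebraMap_iff (algebraMap K L).injective).mpr hd')
    have hsq : IsIntegral ℤ (algebraMap K L (16 * c ^ 2)) := by
      have := (hdiff.mul hdiff).mul h2d'
      rwa [heq2] at this
    have h16 : IsIntegral ℤ (16 * c ^ 2) := (isIntegral_algebraMap_iff (algebraMap K L).injective).mp hsq
    refine IsIntegral.of_pow (n := 2) (by norm_num) ?_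
    have : (4 * c) ^ 2 = 16 * c ^ 2 := by ring
    rwa [this]
  refine ⟨2 * ⟨2 * a, h2a⟩, ⟨4 * c, h4c⟩, ?_⟩
  have h1 : (((2 * ⟨2 * a, h2a⟩ : 𝓞 K)) : K) = 2 * (2 * a) := by push_cast; rfl
  simp only [h1, RingOfIntegers.map_mk, map_mul, map_ofNat]
  ring

end QuadStep

/-! ## §2 The tower `K ⊂ K₁ = K(s₁) ⊂ L = K₁(s₂)`, `s₁² = 2`, `s₂² = 2 + s₁`: four coordinates over `K` -/

section Tower

variable {K K₁ L : Type*} [Field K] [Field K₁] [Field L] [Algebra K K₁] [Algebra K₁ L] [Algebra K L]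
  [IsScalarTower K K₁ L]

/-- **Coordinates**: every `z ∈ L` is `x₀ + x₁s₁ + (x₂ + x₃s₁)s₂` with `x_i ∈ K` (two quadratic steps).
[cite: NeukirchANT1999, Ch. I §2 (bases of field extensions; the tower law)] -/
theorem exists_coord4_of_tower (h1 : Module.finrank K K₁ = 2) (h2 : Module.finrank K₁ L = 2)
    {s₁ : K₁} (hs₁K : ∀ k : K, algebraMap K K₁ k ≠ s₁) {s₂ : L} (hs₂K : ∀ x : K₁, algebraMap K₁ L x ≠ s₂) (z : L) :
    ∃ x₀ x₁ x₂ x₃ : K, z = algebraMap K L x₀ + algebraMap K L x₁ * algebraMap K₁ L s₁ +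
      (algebraMap K L x₂ + algebraMap K L x₃ * algebraMap K₁ L s₁) * s₂ := by
  obtain ⟨P, Q, rfl⟩ := exists_eq_add_mul_of_finrank_eq_two h2 hs₂K z
  obtain ⟨x₀, x₁, rfl⟩ := exists_eq_add_mul_of_finrank_eq_two h1 hs₁K P
  obtain ⟨x₂, x₃, rfl⟩ := exists_eq_add_mul_of_finrank_eq_two h1 hs₁K Q
  refine ⟨x₀, x₁, x₂, x₃, ?_⟩
  simp only [map_add, map_mul, ← IsScalarTower.algebraMap_apply]

/-- **Uniqueness of the four coordinates** (`s₂ ∉ K₁`, `s₁ ∉ K`). [cite: NeukirchANT1999, Ch. I §2 (bases of field extensions)] -/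
theorem coord4_unique_of_tower {s₁ : K₁} (hs₁K : ∀ k : K, algebraMap K K₁ k ≠ s₁) {s₂ : L}
    (hs₂K : ∀ x : K₁, algebraMap K₁ L x ≠ s₂) {x₀ x₁ x₂ x₃ y₀ y₁ y₂ y₃ : K}
    (h : algebraMap K L x₀ + algebraMap K L x₁ * algebraMap K₁ L s₁ +
        (algebraMap K L x₂ + algebraMap K L x₃ * algebraMap K₁ L s₁) * s₂ =
      algebraMap K L y₀ + algebraMap K L y₁ * algebraMap K₁ L s₁ +
        (algebraMap K L y₂ + algebraMap K L y₃ * algebraMap K₁ L s₁) * s₂) :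
    x₀ = y₀ ∧ x₁ = y₁ ∧ x₂ = y₂ ∧ x₃ = y₃ := by
  have h' : algebraMap K₁ L (algebraMap K K₁ x₀ + algebraMap K K₁ x₁ * s₁) +
      algebraMap K₁ L (algebraMap K K₁ x₂ + algebraMap K K₁ x₃ * s₁) * s₂ =
      algebraMap K₁ L (algebraMap K K₁ y₀ + algebraMap K K₁ y₁ * s₁) +
      algebraMap K₁ L (algebraMap K K₁ y₂ + algebraMap K K₁ y₃ * s₁) * s₂ := by
    simpa only [map_add, map_mul, ← IsScalarTower.algebraMap_apply] using h
  obtain ⟨hP, hQ⟩ := coord_unique_of_forall_algebraMap_ne hs₂K h'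
  obtain ⟨h0, h1⟩ := coord_unique_of_forall_algebraMap_ne hs₁K hP
  obtain ⟨h2, h3⟩ := coord_unique_of_forall_algebraMap_ne hs₁K hQ
  exact ⟨h0, h1, h2, h3⟩

omit [Algebra K K₁] [IsScalarTower K K₁ L] in
/-- **The product formula** on the basis `1, s₁, s₂, s₁s₂` (`s₁² = 2`, `s₂² = 2 + s₁`).
[cite: NeukirchANT1999, Ch. I §2 (arithmetic in `K(√d)`)] -/
theorem coord4_mul_of_tower {s₁ : K₁} (hs₁ : s₁ ^ 2 = 2) {s₂ : L} (hs₂ : s₂ ^ 2 = algebraMap K₁ L (2 + s₁))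
    (x₀ x₁ x₂ x₃ y₀ y₁ y₂ y₃ : K) :
    (algebraMap K L x₀ + algebraMap K L x₁ * algebraMap K₁ L s₁ +
        (algebraMap K L x₂ + algebraMap K L x₃ * algebraMap K₁ L s₁) * s₂) *
      (algebraMap K L y₀ + algebraMap K L y₁ * algebraMap K₁ L s₁ +
        (algebraMap K L y₂ + algebraMap K L y₃ * algebraMap K₁ L s₁) * s₂) =
    algebraMap K L (x₀ * y₀ + 2 * x₁ * y₁ + 2 * (x₂ * y₂ + 2 * x₃ * y₃) + 2 * (x₂ * y₃ + x₃ * y₂)) +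
      algebraMap K L (x₀ * y₁ + x₁ * y₀ + (x₂ * y₂ + 2 * x₃ * y₃) + 2 * (x₂ * y₃ + x₃ * y₂)) * algebraMap K₁ L s₁ +
      (algebraMap K L (x₀ * y₂ + 2 * x₁ * y₃ + x₂ * y₀ + 2 * x₃ * y₁) +
        algebraMap K L (x₀ * y₃ + x₁ * y₂ + x₂ * y₁ + x₃ * y₀) * algebraMap K₁ L s₁) * s₂ := by
  have hS : (algebraMap K₁ L s₁) ^ 2 = 2 := by rw [← map_pow, hs₁, map_ofNat]
  have hT : s₂ ^ 2 = 2 + algebraMap K₁ L s₁ := by rw [hs₂, map_add, map_ofNat]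
  simp only [map_add, map_mul, map_ofNat]
  linear_combination (algebraMap K L x₁ * algebraMap K L y₁ +
      (algebraMap K L x₁ * algebraMap K L y₃ + algebraMap K L x₃ * algebraMap K L y₁) * s₂ +
      (algebraMap K L x₂ * algebraMap K L y₃ + algebraMap K L x₃ * algebraMap K L y₂) +
      algebraMap K L x₃ * algebraMap K L y₃ * (2 + algebraMap K₁ L s₁)) * hS +
    ((algebraMap K L x₂ + algebraMap K L x₃ * algebraMap K₁ L s₁) *
      (algebraMap K L y₂ + algebraMap K L y₃ * algebraMap K₁ L s₁)) * hT

omit [Algebra K K₁] [Algebra K₁ L] [Algebra K L] [IsScalarTower K K₁ L] [Field K] [Field K₁] in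
/-- `−1` is not a square in a field with a real embedding. [cite: NeukirchANT1999, Ch. I §7 (roots of unity and real embeddings)] -/
theorem sq_ne_neg_one_of_ringHom_real' (φ : L →+* ℝ) (z : L) : z ^ 2 ≠ -1 := by
  intro hz
  have h := congrArg φ hz
  rw [map_pow, map_neg, map_one] at h
  nlinarith [sq_nonneg (φ z)]

end Tower

/-! ## §3 Integrality in the tower and the residue-symbol obstruction, computed in `𝓞_K` -/

section Residue

variable {K K₁ L : Type*} [Field K] [Field K₁] [NumberField K₁] [Field L] [NumberField L]
  [Algebra K K₁] [Algebra K₁ L] [Algebra K L] [IsScalarTower K K₁ L]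
  [FiniteDimensional K K₁] [IsGalois K K₁] [FiniteDimensional K₁ L] [IsGalois K₁ L]

/-- **`16·𝓞_L` has coordinates in `𝓞_K`**: `z ∈ 𝓞_L ⟹ 16z = p₀ + p₁s₁ + (p₂ + p₃s₁)s₂` with `p_i ∈ 𝓞_K` (§1 for `L/K₁` with `d = 2 + s₁`,
`d' = 2 − s₁`, then for `K₁/K` with `d = 2`). [cite: NeukirchANT1999, Ch. I §2 (integral closure; trace and norm of integral elements)] -/
theorem exists_sixteen_mul_eq_coord4_of_isIntegral (h1 : Module.finrank K K₁ = 2) (h2 : Module.finrank K₁ L = 2)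
    {s₁ : K₁} (hs₁ : s₁ ^ 2 = 2) (hs₁K : ∀ k : K, algebraMap K K₁ k ≠ s₁)
    {s₂ : L} (hs₂ : s₂ ^ 2 = algebraMap K₁ L (2 + s₁)) (hs₂K : ∀ x : K₁, algebraMap K₁ L x ≠ s₂)
    {z : L} (hz : IsIntegral ℤ z) :
    ∃ p₀ p₁ p₂ p₃ : 𝓞 K, 16 * z = algebraMap K L (p₀ : K) + algebraMap K L (p₁ : K) * algebraMap K₁ L s₁ +
      (algebraMap K L (p₂ : K) + algebraMap K L (p₃ : K) * algebraMap K₁ L s₁) * s₂ := by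
  have hs₁int : IsIntegral ℤ s₁ := by
    refine ⟨Polynomial.X ^ 2 - Polynomial.C 2, Polynomial.monic_X_pow_sub_C _ two_ne_zero, ?_⟩
    simp [hs₁]
  have h2int : IsIntegral ℤ (2 : K₁) := by
    have := isIntegral_algebraMap (R := ℤ) (A := K₁) (x := (2 : ℤ))
    rwa [map_ofNat] at this
  have hd' : IsIntegral ℤ (2 - s₁) := h2int.sub hs₁int
  have hdd : (2 + s₁) * (2 - s₁) = 2 := by linear_combination (-1 : K₁) * hs₁
  obtain ⟨P, Q, hPQ⟩ := exists_four_mul_eq_coord_of_isIntegral_of_sq_eq h2 hs₂ hs₂K hd' hdd hz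
  have hs1' : (algebraMap K K₁ (2 : K)) = 2 := map_ofNat _ 2
  have hs₁'' : s₁ ^ 2 = algebraMap K K₁ 2 := by rw [hs1', hs₁]
  obtain ⟨p₀, p₁, hP⟩ := exists_four_mul_eq_coord_of_isIntegral_of_sq_eq (L := K₁) h1 hs₁'' hs₁K
    isIntegral_one (by norm_num) (z := (P : K₁)) (RingOfIntegers.isIntegral_coe P)
  obtain ⟨p₂, p₃, hQ⟩ := exists_four_mul_eq_coord_of_isIntegral_of_sq_eq (L := K₁) h1 hs₁'' hs₁K
    isIntegral_one (by norm_num) (z := (Q : K₁)) (RingOfIntegers.isIntegral_coe Q)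
  refine ⟨p₀, p₁, p₂, p₃, ?_⟩
  have hKL : ∀ x : K, algebraMap K₁ L (algebraMap K K₁ x) = algebraMap K L x := fun x =>
    (IsScalarTower.algebraMap_apply K K₁ L x).symm
  have h16 : 16 * z = algebraMap K₁ L (4 * (P : K₁)) + algebraMap K₁ L (4 * (Q : K₁)) * s₂ := by
    rw [map_mul, map_mul, map_ofNat]
    linear_combination (4 : L) * hPQ
  rw [h16, hP, hQ]
  simp only [map_add, map_mul, hKL]

/-- ★ **The residue-symbol obstruction in the tower.**  `ψ : 𝓞_K → ℤ/q` a ring homomorphism with `2` invertible (`2t = 1`), `r₁, r₂ ∈ ℤ/q`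
with `r₁² = 2`, `r₂² = 2 + r₁`.  If `x₀ + x₁s₁ + (x₂ + x₃s₁)s₂` (`x_i ∈ 𝓞_K`) is a square in `L` then `ψx₀ + ψx₁r₁ + (ψx₂ + ψx₃r₁)r₂` is a square in
`ℤ/q` (`16z` has coordinates `p ∈ 𝓞_K⁴`, `256·x = p ⋆ p` coordinatewise, apply `ψ`).  This is the value at the element of the quadratic character
of the degree-one prime `(ker ψ, s₁ − r₁, s₂ − r₂)` of `L`, computed without constructing it.
[cite: NeukirchANT1999, Ch. I §8 (residue fields of split primes)] [cite: Marcus2018, Ch. 3, Thm. 27] -/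
theorem isSquare_residue4_of_sq_eq_coord (h1 : Module.finrank K K₁ = 2) (h2 : Module.finrank K₁ L = 2)
    {s₁ : K₁} (hs₁ : s₁ ^ 2 = 2) (hs₁K : ∀ k : K, algebraMap K K₁ k ≠ s₁)
    {s₂ : L} (hs₂ : s₂ ^ 2 = algebraMap K₁ L (2 + s₁)) (hs₂K : ∀ x : K₁, algebraMap K₁ L x ≠ s₂)
    {q : ℕ} (ψ : 𝓞 K →+* ZMod q) {t r₁ r₂ : ZMod q} (ht : 2 * t = 1) (hr₁ : r₁ ^ 2 = 2) (hr₂ : r₂ ^ 2 = 2 + r₁)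
    {x₀ x₁ x₂ x₃ : 𝓞 K} {z : L}
    (hz : z ^ 2 = algebraMap K L (x₀ : K) + algebraMap K L (x₁ : K) * algebraMap K₁ L s₁ +
      (algebraMap K L (x₂ : K) + algebraMap K L (x₃ : K) * algebraMap K₁ L s₁) * s₂) :
    IsSquare (ψ x₀ + ψ x₁ * r₁ + (ψ x₂ + ψ x₃ * r₁) * r₂) := by
  -- `z` is integral
  have hs₁int' : IsIntegral ℤ s₁ := by
    refine ⟨Polynomial.X ^ 2 - Polynomial.C 2, Polynomial.monic_X_pow_sub_C _ two_ne_zero, ?_⟩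
    simp [hs₁]
  have hs₁int : IsIntegral ℤ (algebraMap K₁ L s₁) := map_isIntegral_int (algebraMap K₁ L) hs₁int'
  have h2int : IsIntegral ℤ (2 : L) := by
    have := isIntegral_algebraMap (R := ℤ) (A := L) (x := (2 : ℤ))
    rwa [map_ofNat] at this
  have hs₂int : IsIntegral ℤ s₂ := by
    refine IsIntegral.of_pow (n := 2) (by norm_num) ?_
    rw [hs₂, map_add, map_ofNat]
    exact h2int.add hs₁int
  have hcoe : ∀ x : 𝓞 K, IsIntegral ℤ (algebraMap K L (x : K)) := fun x =>
    (isIntegral_algebraMap_iff (algebraMap K L).injective).mpr x.2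
  have hzint : IsIntegral ℤ z := by
    refine IsIntegral.of_pow (n := 2) (by norm_num) ?_
    rw [hz]
    exact ((hcoe x₀).add ((hcoe x₁).mul hs₁int)).add (((hcoe x₂).add ((hcoe x₃).mul hs₁int)).mul hs₂int)
  obtain ⟨p₀, p₁, p₂, p₃, h16⟩ := exists_sixteen_mul_eq_coord4_of_isIntegral h1 h2 hs₁ hs₁K hs₂ hs₂K hzint
  -- compare coordinates of `256 z²`
  have h256 := coord4_mul_of_tower (K := K) hs₁ hs₂ (p₀ : K) p₁ p₂ p₃ p₀ p₁ p₂ p₃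
  rw [← h16] at h256
  have hlhs : 16 * z * (16 * z) = algebraMap K L ((256 : K) * x₀) + algebraMap K L ((256 : K) * x₁) * algebraMap K₁ L s₁ +
      (algebraMap K L ((256 : K) * x₂) + algebraMap K L ((256 : K) * x₃) * algebraMap K₁ L s₁) * s₂ := by
    simp only [map_mul, map_ofNat]
    linear_combination (256 : L) * hz
  rw [hlhs] at h256
  obtain ⟨hA, hB, hC, hD⟩ := coord4_unique_of_tower hs₁K hs₂K h256
  have hA' : (256 : 𝓞 K) * x₀ = p₀ * p₀ + 2 * p₁ * p₁ + 2 * (p₂ * p₂ + 2 * p₃ * p₃) + 2 * (p₂ * p₃ + p₃ * p₂) := by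
    apply RingOfIntegers.coe_injective; push_cast; exact hA
  have hB' : (256 : 𝓞 K) * x₁ = p₀ * p₁ + p₁ * p₀ + (p₂ * p₂ + 2 * p₃ * p₃) + 2 * (p₂ * p₃ + p₃ * p₂) := by
    apply RingOfIntegers.coe_injective; push_cast; exact hB
  have hC' : (256 : 𝓞 K) * x₂ = p₀ * p₂ + 2 * p₁ * p₃ + p₂ * p₀ + 2 * p₃ * p₁ := by
    apply RingOfIntegers.coe_injective; push_cast; exact hC
  have hD' : (256 : 𝓞 K) * x₃ = p₀ * p₃ + p₁ * p₂ + p₂ * p₁ + p₃ * p₀ := by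
    apply RingOfIntegers.coe_injective; push_cast; exact hD
  have hψA := congrArg ψ hA'
  have hψB := congrArg ψ hB'
  have hψC := congrArg ψ hC'
  have hψD := congrArg ψ hD'
  simp only [map_mul, map_add, map_ofNat] at hψA hψB hψC hψD
  refine ⟨(ψ p₀ + ψ p₁ * r₁ + (ψ p₂ + ψ p₃ * r₁) * r₂) * t ^ 4, ?_⟩
  have ht8 : (256 : ZMod q) * t ^ 8 = 1 := by linear_combination (128 * t ^ 7 + 64 * t ^ 6 + 32 * t ^ 5 + 16 * t ^ 4 +
    8 * t ^ 3 + 4 * t ^ 2 + 2 * t + 1) * ht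
  linear_combination (t ^ 8) * hψA + (t ^ 8 * r₁) * hψB + (t ^ 8 * r₂) * hψC + (t ^ 8 * r₁ * r₂) * hψD +
    (-(t ^ 8) * (ψ p₁ * ψ p₁ + (ψ p₁ * ψ p₃ + ψ p₃ * ψ p₁) * r₂ + (ψ p₂ * ψ p₃ + ψ p₃ * ψ p₂) +
      ψ p₃ * ψ p₃ * (2 + r₁))) * hr₁ +
    (-(t ^ 8) * ((ψ p₂ + ψ p₃ * r₁) * (ψ p₂ + ψ p₃ * r₁))) * hr₂ +
    (-(ψ x₀ + ψ x₁ * r₁ + (ψ x₂ + ψ x₃ * r₁) * r₂)) * ht8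


omit [NumberField K₁] [NumberField L] [Algebra K K₁] [IsScalarTower K K₁ L] [FiniteDimensional K K₁] [IsGalois K K₁]
  [FiniteDimensional K₁ L] [IsGalois K₁ L] in
/-- **Coordinates of a product, with the symbol**: closure of «has `𝓞_K`-coordinates with symbol `v`» under multiplication
(the product formula of §2 read through `ψ`, `r₁² = 2`, `r₂² = 2 + r₁`). [folklore] -/
private theorem exists_coord4_mul_of_coord4 {s₁ : K₁} (hs₁ : s₁ ^ 2 = 2) {s₂ : L}
    (hs₂ : s₂ ^ 2 = algebraMap K₁ L (2 + s₁)) {q : ℕ} (ψ : 𝓞 K →+* ZMod q) {r₁ r₂ : ZMod q}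
    (hr₁ : r₁ ^ 2 = 2) (hr₂ : r₂ ^ 2 = 2 + r₁) {y y' : L} {v v' : ZMod q}
    (hy : ∃ A₀ A₁ A₂ A₃ : 𝓞 K, y = algebraMap K L (A₀ : K) + algebraMap K L (A₁ : K) * algebraMap K₁ L s₁ +
      (algebraMap K L (A₂ : K) + algebraMap K L (A₃ : K) * algebraMap K₁ L s₁) * s₂ ∧
      ψ A₀ + ψ A₁ * r₁ + (ψ A₂ + ψ A₃ * r₁) * r₂ = v)
    (hy' : ∃ C₀ C₁ C₂ C₃ : 𝓞 K, y' = algebraMap K L (C₀ : K) + algebraMap K L (C₁ : K) * algebraMap K₁ L s₁ +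
      (algebraMap K L (C₂ : K) + algebraMap K L (C₃ : K) * algebraMap K₁ L s₁) * s₂ ∧
      ψ C₀ + ψ C₁ * r₁ + (ψ C₂ + ψ C₃ * r₁) * r₂ = v') :
    ∃ E₀ E₁ E₂ E₃ : 𝓞 K, y * y' = algebraMap K L (E₀ : K) + algebraMap K L (E₁ : K) * algebraMap K₁ L s₁ +
      (algebraMap K L (E₂ : K) + algebraMap K L (E₃ : K) * algebraMap K₁ L s₁) * s₂ ∧
      ψ E₀ + ψ E₁ * r₁ + (ψ E₂ + ψ E₃ * r₁) * r₂ = v * v' := by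
  obtain ⟨A₀, A₁, A₂, A₃, rfl, rfl⟩ := hy
  obtain ⟨C₀, C₁, C₂, C₃, rfl, rfl⟩ := hy'
  have hS : (algebraMap K₁ L s₁) ^ 2 = 2 := by rw [← map_pow, hs₁, map_ofNat]
  have hT : s₂ ^ 2 = 2 + algebraMap K₁ L s₁ := by rw [hs₂, map_add, map_ofNat]
  refine ⟨A₀ * C₀ + (A₁ * C₁ + A₁ * C₁) + ((A₂ * C₂ + A₃ * C₃ + A₃ * C₃) + (A₂ * C₂ + A₃ * C₃ + A₃ * C₃)) +
      ((A₂ * C₃ + A₃ * C₂) + (A₂ * C₃ + A₃ * C₂)),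
    A₀ * C₁ + A₁ * C₀ + (A₂ * C₂ + A₃ * C₃ + A₃ * C₃) + ((A₂ * C₃ + A₃ * C₂) + (A₂ * C₃ + A₃ * C₂)),
    A₀ * C₂ + (A₁ * C₃ + A₁ * C₃) + A₂ * C₀ + (A₃ * C₁ + A₃ * C₁),
    A₀ * C₃ + A₁ * C₂ + A₂ * C₁ + A₃ * C₀, ?_, ?_⟩
  · push_cast
    linear_combination (algebraMap K L (A₁ : K) * algebraMap K L (C₁ : K) +
      (algebraMap K L (A₁ : K) * algebraMap K L (C₃ : K) + algebraMap K L (A₃ : K) * algebraMap K L (C₁ : K)) * s₂ +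
      (algebraMap K L (A₂ : K) * algebraMap K L (C₃ : K) + algebraMap K L (A₃ : K) * algebraMap K L (C₂ : K)) +
      algebraMap K L (A₃ : K) * algebraMap K L (C₃ : K) * (2 + algebraMap K₁ L s₁)) * hS +
    ((algebraMap K L (A₂ : K) + algebraMap K L (A₃ : K) * algebraMap K₁ L s₁) *
      (algebraMap K L (C₂ : K) + algebraMap K L (C₃ : K) * algebraMap K₁ L s₁)) * hT
  · simp only [map_add, map_mul]
    linear_combination (-(ψ A₁ * ψ C₁ + (ψ A₁ * ψ C₃ + ψ A₃ * ψ C₁) * r₂ + (ψ A₂ * ψ C₃ + ψ A₃ * ψ C₂) +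
      ψ A₃ * ψ C₃ * (2 + r₁))) * hr₁ + (-((ψ A₂ + ψ A₃ * r₁) * (ψ C₂ + ψ C₃ * r₁))) * hr₂

omit [NumberField K₁] [NumberField L] [Algebra K K₁] [IsScalarTower K K₁ L] [FiniteDimensional K K₁] [IsGalois K K₁]
  [FiniteDimensional K₁ L] [IsGalois K₁ L] in
/-- **Coordinates of a power, with the symbol.** [folklore] -/
private theorem exists_coord4_pow_of_coord4 {s₁ : K₁} (hs₁ : s₁ ^ 2 = 2) {s₂ : L}
    (hs₂ : s₂ ^ 2 = algebraMap K₁ L (2 + s₁)) {q : ℕ} (ψ : 𝓞 K →+* ZMod q) {r₁ r₂ : ZMod q}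
    (hr₁ : r₁ ^ 2 = 2) (hr₂ : r₂ ^ 2 = 2 + r₁) {y : L} {v : ZMod q}
    (hy : ∃ A₀ A₁ A₂ A₃ : 𝓞 K, y = algebraMap K L (A₀ : K) + algebraMap K L (A₁ : K) * algebraMap K₁ L s₁ +
      (algebraMap K L (A₂ : K) + algebraMap K L (A₃ : K) * algebraMap K₁ L s₁) * s₂ ∧
      ψ A₀ + ψ A₁ * r₁ + (ψ A₂ + ψ A₃ * r₁) * r₂ = v) (k : ℕ) :
    ∃ E₀ E₁ E₂ E₃ : 𝓞 K, y ^ k = algebraMap K L (E₀ : K) + algebraMap K L (E₁ : K) * algebraMap K₁ L s₁ +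
      (algebraMap K L (E₂ : K) + algebraMap K L (E₃ : K) * algebraMap K₁ L s₁) * s₂ ∧
      ψ E₀ + ψ E₁ * r₁ + (ψ E₂ + ψ E₃ * r₁) * r₂ = v ^ k := by
  induction k with
  | zero => exact ⟨1, 0, 0, 0, by simp, by simp⟩
  | succ k ih =>
    obtain ⟨E₀, E₁, E₂, E₃, hE, hv⟩ := exists_coord4_mul_of_coord4 hs₁ hs₂ ψ hr₁ hr₂ ih hy
    exact ⟨E₀, E₁, E₂, E₃, by rw [pow_succ, hE], by rw [pow_succ, hv]⟩

omit [NumberField K₁] [NumberField L] [Algebra K K₁] [IsScalarTower K K₁ L] [FiniteDimensional K K₁] [IsGalois K K₁]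
  [FiniteDimensional K₁ L] [IsGalois K₁ L] in
/-- **Coordinates of a finite product of powers, with the symbol.** [folklore] -/
private theorem exists_coord4_prod_of_coord4 {s₁ : K₁} (hs₁ : s₁ ^ 2 = 2) {s₂ : L}
    (hs₂ : s₂ ^ 2 = algebraMap K₁ L (2 + s₁)) {q : ℕ} (ψ : 𝓞 K →+* ZMod q) {r₁ r₂ : ZMod q}
    (hr₁ : r₁ ^ 2 = 2) (hr₂ : r₂ ^ 2 = 2 + r₁) {n : ℕ} (x : Fin n → L) (v : Fin n → ZMod q)
    (hx : ∀ i, ∃ A₀ A₁ A₂ A₃ : 𝓞 K, x i = algebraMap K L (A₀ : K) + algebraMap K L (A₁ : K) * algebraMap K₁ L s₁ +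
      (algebraMap K L (A₂ : K) + algebraMap K L (A₃ : K) * algebraMap K₁ L s₁) * s₂ ∧
      ψ A₀ + ψ A₁ * r₁ + (ψ A₂ + ψ A₃ * r₁) * r₂ = v i) (e : Fin n → ℕ) :
    ∃ E₀ E₁ E₂ E₃ : 𝓞 K, ∏ i, x i ^ e i = algebraMap K L (E₀ : K) + algebraMap K L (E₁ : K) * algebraMap K₁ L s₁ +
      (algebraMap K L (E₂ : K) + algebraMap K L (E₃ : K) * algebraMap K₁ L s₁) * s₂ ∧
      ψ E₀ + ψ E₁ * r₁ + (ψ E₂ + ψ E₃ * r₁) * r₂ = ∏ i, v i ^ e i := by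
  induction n with
  | zero => exact ⟨1, 0, 0, 0, by simp, by simp⟩
  | succ n ih =>
    obtain ⟨E₀, E₁, E₂, E₃, hE, hv⟩ := ih (fun i => x i.succ) (fun i => v i.succ) (fun i => hx i.succ) (fun i => e i.succ)
    obtain ⟨F₀, F₁, F₂, F₃, hF, hw⟩ := exists_coord4_mul_of_coord4 hs₁ hs₂ ψ hr₁ hr₂
      (exists_coord4_pow_of_coord4 hs₁ hs₂ ψ hr₁ hr₂ (hx 0) (e 0)) ⟨E₀, E₁, E₂, E₃, hE, hv⟩
    refine ⟨F₀, F₁, F₂, F₃, ?_, ?_⟩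
    · rw [Fin.prod_univ_succ, hF]
    · rw [Fin.prod_univ_succ, hw]

/-- ★ **The obstruction for a signed product `±∏ u_i^{e_i} · w^{e'}` of coordinate elements**: if it is a square in `L` then
`±∏ sym(u_i)^{e_i} · sym(w)^{e'}` is a square in `ℤ/q` (`isSquare_residue4_of_sq_eq_coord`; the symbol is multiplicative).
[cite: NeukirchANT1999, Ch. I §8 (residue fields of split primes)] [cite: Marcus2018, Ch. 3, Thm. 27] -/
theorem isSquare_residue4_of_sq_eq_prod (h1 : Module.finrank K K₁ = 2) (h2 : Module.finrank K₁ L = 2)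
    {s₁ : K₁} (hs₁ : s₁ ^ 2 = 2) (hs₁K : ∀ k : K, algebraMap K K₁ k ≠ s₁)
    {s₂ : L} (hs₂ : s₂ ^ 2 = algebraMap K₁ L (2 + s₁)) (hs₂K : ∀ x : K₁, algebraMap K₁ L x ≠ s₂)
    {q : ℕ} (ψ : 𝓞 K →+* ZMod q) {t r₁ r₂ : ZMod q} (ht : 2 * t = 1) (hr₁ : r₁ ^ 2 = 2) (hr₂ : r₂ ^ 2 = 2 + r₁)
    {n : ℕ} {x : Fin n → L} (a₀ a₁ a₂ a₃ : Fin n → 𝓞 K) {y : L} (A₀ A₁ A₂ A₃ : 𝓞 K)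
    (hx : ∀ i, x i = algebraMap K L (a₀ i : K) + algebraMap K L (a₁ i : K) * algebraMap K₁ L s₁ +
      (algebraMap K L (a₂ i : K) + algebraMap K L (a₃ i : K) * algebraMap K₁ L s₁) * s₂)
    (hy : y = algebraMap K L (A₀ : K) + algebraMap K L (A₁ : K) * algebraMap K₁ L s₁ +
      (algebraMap K L (A₂ : K) + algebraMap K L (A₃ : K) * algebraMap K₁ L s₁) * s₂)
    (e : Fin n → ℕ) (e' : ℕ) (σ : ℤˣ) {z : L}
    (hz : z ^ 2 = ((σ : ℤ) : L) * (∏ i, x i ^ e i) * y ^ e') :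
    IsSquare (((σ : ℤ) : ZMod q) * (∏ i, (ψ (a₀ i) + ψ (a₁ i) * r₁ + (ψ (a₂ i) + ψ (a₃ i) * r₁) * r₂) ^ e i) *
      (ψ A₀ + ψ A₁ * r₁ + (ψ A₂ + ψ A₃ * r₁) * r₂) ^ e') := by
  have hσ : ∃ S₀ S₁ S₂ S₃ : 𝓞 K, ((σ : ℤ) : L) = algebraMap K L (S₀ : K) + algebraMap K L (S₁ : K) * algebraMap K₁ L s₁ +
      (algebraMap K L (S₂ : K) + algebraMap K L (S₃ : K) * algebraMap K₁ L s₁) * s₂ ∧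
      ψ S₀ + ψ S₁ * r₁ + (ψ S₂ + ψ S₃ * r₁) * r₂ = ((σ : ℤ) : ZMod q) := by
    refine ⟨(σ : ℤ), 0, 0, 0, ?_, ?_⟩
    · push_cast; simp
    · simp
  have hP := exists_coord4_prod_of_coord4 hs₁ hs₂ ψ hr₁ hr₂ x
    (fun i => ψ (a₀ i) + ψ (a₁ i) * r₁ + (ψ (a₂ i) + ψ (a₃ i) * r₁) * r₂)
    (fun i => ⟨a₀ i, a₁ i, a₂ i, a₃ i, hx i, rfl⟩) e
  have hY := exists_coord4_pow_of_coord4 hs₁ hs₂ ψ hr₁ hr₂ ⟨A₀, A₁, A₂, A₃, hy, rfl⟩ e'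
  obtain ⟨E₀, E₁, E₂, E₃, hE, hv⟩ := exists_coord4_mul_of_coord4 hs₁ hs₂ ψ hr₁ hr₂
    (exists_coord4_mul_of_coord4 hs₁ hs₂ ψ hr₁ hr₂ hσ hP) hY
  rw [← hv]
  exact isSquare_residue4_of_sq_eq_coord h1 h2 hs₁ hs₁K hs₂ hs₂K ψ ht hr₁ hr₂ (z := z) (by rw [hz, hE])

end Residue

/-! ## §4 Infinite places in a quadratic step -/

section Places

/-- **`#Pl_∞(L) ≤ 2·#Pl_∞(K)`** for `L/K` Galois of degree `2`: every infinite place of `K` has at most two places of `L` above it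
(Mathlib `InfinitePlace.card_eq_card_isUnramifiedIn`). [cite: NeukirchANT1999, Ch. I §7 Thm. (7.4) and Ch. III §1] -/
theorem card_infinitePlace_le_two_mul_of_finrank_eq_two {K L : Type*} [Field K] [NumberField K] [Field L] [NumberField L]
    [Algebra K L] [IsGalois K L] (h2 : Module.finrank K L = 2) :
    Fintype.card (InfinitePlace L) ≤ 2 * Fintype.card (InfinitePlace K) := by
  classical
  have hcard := NumberField.InfinitePlace.card_eq_card_isUnramifiedIn (k := K) (K := L)
  rw [h2] at hcard
  have htot := Finset.card_add_card_compl (Finset.univ.filter fun w : InfinitePlace K => w.IsUnramifiedIn L)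
  rw [hcard, ← htot]; omega

/-- **A real place of `L` gives `L →+* ℝ`** (Mathlib `embedding_of_isReal`). [folklore] -/
private theorem exists_ringHom_real_of_nrRealPlaces_pos' {L : Type*} [Field L] [NumberField L]
    (h : 0 < NumberField.InfinitePlace.nrRealPlaces L) : Nonempty (L →+* ℝ) := by
  classical
  obtain ⟨⟨w, hw⟩⟩ := Fintype.card_pos_iff.mp h
  exact ⟨NumberField.InfinitePlace.embedding_of_isReal hw⟩

end Places

/-! ## §5 The order-four certificate in the tower -/

section Main

variable {K K₁ L : Type*} [Field K] [Field K₁] [NumberField K₁] [Field L] [NumberField L]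
  [Algebra K K₁] [Algebra K₁ L] [Algebra K L] [IsScalarTower K K₁ L]
  [FiniteDimensional K K₁] [IsGalois K K₁] [FiniteDimensional K₁ L] [IsGalois K₁ L]

/-- ★★ **THE ORDER-FOUR CERTIFICATE IN THE TOWER: a class of order `4` in `Cl(L)`.**  Tower `K ⊂ K₁ ⊂ L` of quadratic Galois steps,
`s₁ ∈ K₁ ∖ K` with `s₁² = 2`, `s₂ ∈ L ∖ K₁` with `s₂² = 2 + s₁`; `L` has a real place (so `√−1 ∉ L`) and `rank E_L < n + 1`.  DATA: units
`u_i` (`i < n`) of `𝓞_L` and an element `w` with `𝓞_K`-coordinates on `1, s₁, s₂, s₁s₂`; `b ≠ 0`, `v ∈ 𝓞_L` with `(b, v)² = (w, b²)` and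
`(w, b²)² = (w)`; and RESIDUE CERTIFICATES: for every `(e, e', ±) ≠ (0, 0, +)` (`e_i, e' ∈ {0,1}`) a ring homomorphism `ψ : 𝓞_K → ℤ/q` with `2`
invertible and `r₁, r₂ ∈ ℤ/q`, `r₁² = 2`, `r₂² = 2 + r₁`, at which `±∏ sym(u_i)^{e_i}·sym(w)^{e'}` is NOT a square.  THEN the class of `𝔅 = (b, v)` has
ORDER `4` in `Cl(L)`.  PROOF.  If `(w, b²) = (y)` then `w = u y²` with `u` a unit; Dirichlet applied to the `n + 1` units `u, u_0, …, u_{n−1}`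
gives `(e, ±) ≠ 0` with `±u^{e'}∏u_i^{e_i}` the square of a unit, hence `±∏u_i^{e_i} w^{e'}` a square in `L`, contradicting the certificate via §3.
So `[𝔅]² ≠ 1 = [𝔅]⁴`. [cite: NeukirchANT1999, Ch. I §7 Thm. (7.4), Ch. I §3 (ideal classes), Ch. I §8 (split primes)]
[cite: Cohen1993, §6.5 (verification of class group and unit computations)] [cite: Marcus2018, Ch. 5 (class group computations)] -/
theorem exists_orderOf_eq_four_of_towerOrderFourCert (h1 : Module.finrank K K₁ = 2) (h2 : Module.finrank K₁ L = 2)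
    {s₁ : K₁} (hs₁ : s₁ ^ 2 = 2) (hs₁K : ∀ k : K, algebraMap K K₁ k ≠ s₁)
    {s₂ : L} (hs₂ : s₂ ^ 2 = algebraMap K₁ L (2 + s₁)) (hs₂K : ∀ x : K₁, algebraMap K₁ L x ≠ s₂)
    (hreal : 0 < NumberField.InfinitePlace.nrRealPlaces L) {n : ℕ} (hrank : rank L < n + 1)
    (u : Fin n → (𝓞 L)ˣ) (a₀ a₁ a₂ a₃ : Fin n → 𝓞 K) {A₀ A₁ A₂ A₃ : 𝓞 K} {w b v : 𝓞 L}
    (hu : ∀ i, (((u i : 𝓞 L)) : L) = algebraMap K L (a₀ i : K) + algebraMap K L (a₁ i : K) * algebraMap K₁ L s₁ +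
      (algebraMap K L (a₂ i : K) + algebraMap K L (a₃ i : K) * algebraMap K₁ L s₁) * s₂)
    (hw : ((w : 𝓞 L) : L) = algebraMap K L (A₀ : K) + algebraMap K L (A₁ : K) * algebraMap K₁ L s₁ +
      (algebraMap K L (A₂ : K) + algebraMap K L (A₃ : K) * algebraMap K₁ L s₁) * s₂)
    (hb : b ≠ 0)
    (hI2 : (Ideal.span {b, v}) ^ 2 = Ideal.span {w, b ^ 2}) (hI4 : (Ideal.span {w, b ^ 2}) ^ 2 = Ideal.span {w})
    (hcert : ∀ (e : Fin n → ℕ) (e' : ℕ) (σ : ℤˣ), (∀ i, e i ≤ 1) → e' ≤ 1 → ¬ (e = 0 ∧ e' = 0 ∧ σ = 1) →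
      ∃ (q : ℕ) (ψ : 𝓞 K →+* ZMod q) (t r₁ r₂ : ZMod q), 2 * t = 1 ∧ r₁ ^ 2 = 2 ∧ r₂ ^ 2 = 2 + r₁ ∧
        ¬ IsSquare (((σ : ℤ) : ZMod q) *
          (∏ i, (ψ (a₀ i) + ψ (a₁ i) * r₁ + (ψ (a₂ i) + ψ (a₃ i) * r₁) * r₂) ^ e i) *
          (ψ A₀ + ψ A₁ * r₁ + (ψ A₂ + ψ A₃ * r₁) * r₂) ^ e')) :
    ∃ c : ClassGroup (𝓞 L), orderOf c = 4 := by
  classical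
  haveI : Fact (Nat.Prime 2) := ⟨Nat.prime_two⟩
  obtain ⟨φ⟩ := exists_ringHom_real_of_nrRealPlaces_pos' hreal
  have hi : ∀ z : L, z ^ 2 ≠ -1 := sq_ne_neg_one_of_ringHom_real' φ
  -- no `±∏ u_i^{e_i} w^{e'}` with `(e, e', ±) ≠ 0` is a square in `L`
  have hnsq : ∀ (e : Fin n → ℕ) (e' : ℕ) (σ : ℤˣ), (∀ i, e i ≤ 1) → e' ≤ 1 → ¬ (e = 0 ∧ e' = 0 ∧ σ = 1) →
      ∀ z : L, z ^ 2 ≠ ((σ : ℤ) : L) * (∏ i, (((u i : 𝓞 L)) : L) ^ e i) * ((w : 𝓞 L) : L) ^ e' := by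
    intro e e' σ he he' hne z hz
    obtain ⟨q, ψ, t, r₁, r₂, ht, hr₁, hr₂, hns⟩ := hcert e e' σ he he' hne
    exact hns (isSquare_residue4_of_sq_eq_prod h1 h2 hs₁ hs₁K hs₂ hs₂K ψ ht hr₁ hr₂ a₀ a₁ a₂ a₃ A₀ A₁ A₂ A₃
      hu hw e e' σ hz)
  -- `𝔍 = (w, b²)` is not principal
  have hJ : ¬ (Ideal.span {w, b ^ 2}).IsPrincipal := by
    rintro ⟨y, hy⟩
    rw [Ideal.submodule_span_eq] at hy
    have hy2 : Ideal.span {y ^ 2} = Ideal.span {w} := by rw [← Ideal.span_singleton_pow, ← hy, hI4]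
    obtain ⟨uw, huw⟩ := Ideal.span_singleton_eq_span_singleton.mp hy2
    -- a relation among `uw, u_0, …, u_{n-1}`
    obtain ⟨e, he1, he0, g, hg⟩ := exists_prod_pow_eq_sq_of_rank_lt hi hrank (Fin.cons uw u)
    rw [Fin.prod_univ_succ] at hg
    simp only [Fin.cons_zero, Fin.cons_succ] at hg
    -- the sign and the square
    have hsq : ∃ (σ : ℤˣ) (g' : L),
        g' ^ 2 = ((σ : ℤ) : L) * (∏ i, (((u i : 𝓞 L)) : L) ^ e i.succ) * ((w : 𝓞 L) : L) ^ e 0 := by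
      have hwe : ((uw : 𝓞 L)) ^ e 0 * (y ^ e 0) ^ 2 = w ^ e 0 := by
        rw [← huw]; ring
      have hwe' := congrArg (fun x : 𝓞 L => (x : L)) hwe
      push_cast at hwe'
      rcases hg with hg | hg
      · refine ⟨1, (((g : 𝓞 L)) : L) * ((y : 𝓞 L) : L) ^ e 0, ?_⟩
        have hg' := congrArg (fun x : (𝓞 L)ˣ => (((x : 𝓞 L)) : L)) hg
        simp only [Units.val_mul, Units.val_pow_eq_pow_val] at hg'
        push_cast at hg' ⊢
        rw [← hwe']
        linear_combination (-(((y : 𝓞 L) : L) ^ e 0) ^ 2) * hg'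
      · refine ⟨-1, (((g : 𝓞 L)) : L) * ((y : 𝓞 L) : L) ^ e 0, ?_⟩
        have hg' := congrArg (fun x : (𝓞 L)ˣ => (((x : 𝓞 L)) : L)) hg
        simp only [Units.val_mul, Units.val_pow_eq_pow_val, Units.val_neg] at hg'
        push_cast at hg' ⊢
        rw [← hwe']
        linear_combination ((((y : 𝓞 L) : L) ^ e 0) ^ 2) * hg'
    obtain ⟨σ, g', hg'⟩ := hsq
    refine hnsq (fun i => e i.succ) (e 0) σ (fun i => he1 i.succ) (he1 0) ?_ g' hg'
    rintro ⟨hsucc, h0, -⟩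
    apply he0
    ext i
    refine Fin.cases ?_ (fun j => ?_) i
    · exact h0
    · exact congrFun hsucc j
  -- the class of `𝔅 = (b, v)` has order `4`
  set I : Ideal (𝓞 L) := Ideal.span {b, v} with hI
  have hI0 : I ≠ ⊥ := fun h => hb (by
    have : b ∈ I := Ideal.subset_span (by simp)
    rw [h, Submodule.mem_bot] at this; exact this)
  have hImem : I ∈ (Ideal (𝓞 L))⁰ := mem_nonZeroDivisors_iff_ne_zero.mpr hI0
  refine ⟨ClassGroup.mk0 ⟨I, hImem⟩, ?_⟩
  set c := ClassGroup.mk0 ⟨I, hImem⟩ with hc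
  have hJmem : Ideal.span {w, b ^ 2} ∈ (Ideal (𝓞 L))⁰ := by
    rw [← hI2]; exact pow_mem hImem 2
  have hc2 : c ^ 2 = ClassGroup.mk0 ⟨Ideal.span {w, b ^ 2}, hJmem⟩ := by
    rw [hc, ← map_pow]; congr 1; exact Subtype.ext (by simp [hI2])
  have hc2ne : c ^ 2 ≠ 1 := by
    rw [hc2, Ne, ClassGroup.mk0_eq_one_iff]; exact hJ
  have hwmem : Ideal.span {w} ∈ (Ideal (𝓞 L))⁰ := by
    rw [← hI4]; exact pow_mem hJmem 2
  have hc4 : c ^ 4 = 1 := by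
    have : c ^ 4 = (c ^ 2) ^ 2 := by rw [← pow_mul]
    rw [this, hc2, ← map_pow]
    have heq : (⟨Ideal.span {w, b ^ 2}, hJmem⟩ : (Ideal (𝓞 L))⁰) ^ 2 = ⟨Ideal.span {w}, hwmem⟩ :=
      Subtype.ext (by simp [hI4])
    rw [heq, ClassGroup.mk0_eq_one_iff]
    exact ⟨⟨w, by rw [Ideal.submodule_span_eq]⟩⟩
  have := orderOf_eq_prime_pow (p := 2) (n := 1) (x := c) (by rw [pow_one]; exact hc2ne) (by norm_num; exact hc4)
  rw [this]; norm_num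

/-- ★★ **`4 ∣ h_L`** under the tower order-four certificate. [cite: NeukirchANT1999, Ch. I §7 Thm. (7.4), Ch. I §3] -/
theorem four_dvd_card_classGroup_of_towerOrderFourCert (h1 : Module.finrank K K₁ = 2) (h2 : Module.finrank K₁ L = 2)
    {s₁ : K₁} (hs₁ : s₁ ^ 2 = 2) (hs₁K : ∀ k : K, algebraMap K K₁ k ≠ s₁)
    {s₂ : L} (hs₂ : s₂ ^ 2 = algebraMap K₁ L (2 + s₁)) (hs₂K : ∀ x : K₁, algebraMap K₁ L x ≠ s₂)
    (hreal : 0 < NumberField.InfinitePlace.nrRealPlaces L) {n : ℕ} (hrank : rank L < n + 1)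
    (u : Fin n → (𝓞 L)ˣ) (a₀ a₁ a₂ a₃ : Fin n → 𝓞 K) {A₀ A₁ A₂ A₃ : 𝓞 K} {w b v : 𝓞 L}
    (hu : ∀ i, (((u i : 𝓞 L)) : L) = algebraMap K L (a₀ i : K) + algebraMap K L (a₁ i : K) * algebraMap K₁ L s₁ +
      (algebraMap K L (a₂ i : K) + algebraMap K L (a₃ i : K) * algebraMap K₁ L s₁) * s₂)
    (hw : ((w : 𝓞 L) : L) = algebraMap K L (A₀ : K) + algebraMap K L (A₁ : K) * algebraMap K₁ L s₁ +
      (algebraMap K L (A₂ : K) + algebraMap K L (A₃ : K) * algebraMap K₁ L s₁) * s₂)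
    (hb : b ≠ 0)
    (hI2 : (Ideal.span {b, v}) ^ 2 = Ideal.span {w, b ^ 2}) (hI4 : (Ideal.span {w, b ^ 2}) ^ 2 = Ideal.span {w})
    (hcert : ∀ (e : Fin n → ℕ) (e' : ℕ) (σ : ℤˣ), (∀ i, e i ≤ 1) → e' ≤ 1 → ¬ (e = 0 ∧ e' = 0 ∧ σ = 1) →
      ∃ (q : ℕ) (ψ : 𝓞 K →+* ZMod q) (t r₁ r₂ : ZMod q), 2 * t = 1 ∧ r₁ ^ 2 = 2 ∧ r₂ ^ 2 = 2 + r₁ ∧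
        ¬ IsSquare (((σ : ℤ) : ZMod q) *
          (∏ i, (ψ (a₀ i) + ψ (a₁ i) * r₁ + (ψ (a₂ i) + ψ (a₃ i) * r₁) * r₂) ^ e i) *
          (ψ A₀ + ψ A₁ * r₁ + (ψ A₂ + ψ A₃ * r₁) * r₂) ^ e')) :
    4 ∣ Nat.card (ClassGroup (𝓞 L)) := by
  obtain ⟨c, hc⟩ := exists_orderOf_eq_four_of_towerOrderFourCert h1 h2 hs₁ hs₁K hs₂ hs₂K hreal hrank u a₀ a₁ a₂ a₃
    hu hw hb hI2 hI4 hcert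
  rw [← hc]
  exact orderOf_dvd_natCard c

end Main

/-! ## §6 The character matrix: `m` residue characters with an `𝔽₂`-left-invertible Euler-bit matrix supply all the certificates -/

section CharMatrix

/-- **Euler's criterion, contrapositive half**: in `ℤ/q` (`q` prime, `2` invertible), `x^{(q−1)/2} = −1` forces `x` to be a non-square
(`x = y²`, `y ≠ 0` ⟹ `x^{(q−1)/2} = y^{q−1} = 1 ≠ −1`). [cite: Serre1973CourseArithmetic, Ch. I §3.1 (Euler's criterion)] -/
theorem not_isSquare_of_pow_div_two_eq_neg_one {q : ℕ} [hq : Fact q.Prime] {t : ZMod q} (ht : 2 * t = 1)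
    {x : ZMod q} (hx : x ^ (q / 2) = -1) : ¬ IsSquare x := by
  have h2 : (2 : ZMod q) ≠ 0 := fun h => by
    rw [h, zero_mul] at ht; exact zero_ne_one ht
  have hq2 : q ≠ 2 := by
    rintro rfl; apply h2; exact_mod_cast ZMod.natCast_self 2
  have hodd : q % 2 = 1 := Nat.odd_iff.mp (hq.out.odd_of_ne_two hq2)
  have hq0 : q / 2 ≠ 0 := by have := hq.out.two_le; omega
  rintro ⟨y, rfl⟩
  have hy : y ≠ 0 := by
    rintro rfl
    rw [mul_zero, zero_pow hq0] at hx
    exact h2 (by linear_combination (2 : ZMod q) * hx)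
  have hpow : (y * y) ^ (q / 2) = y ^ (q - 1) := by
    rw [← sq, ← pow_mul]; congr 1; omega
  rw [hpow, ZMod.pow_card_sub_one_eq_one hy] at hx
  exact h2 (by linear_combination hx)

/-- `(−1)^{(q−1)/2·E}`-bookkeeping: `(x^{(q−1)/2} = (−1)^b) ⟹ (x^E)^{(q−1)/2} = (−1)^{bE}`. [folklore] -/
private theorem pow_pow_div_two_eq {q : ℕ} {x : ZMod q} {b : ℕ} (hx : x ^ (q / 2) = (-1) ^ b) (E : ℕ) :
    (x ^ E) ^ (q / 2) = (-1) ^ (b * E) := by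
  rw [← pow_mul, mul_comm, pow_mul, hx, ← pow_mul]

/-- ★ **THE CHARACTER MATRIX supplies the residue certificates.**  Generators `g = (−1, u_0, …, u_{n−1}, w)` indexed by `Fin (n+2)` (`0` ↦ the
sign, `i+1` ↦ `u_i`, `n+1` ↦ `w`), each with four `R`-coordinates; `m` residue characters: for each `j < m` a prime `q`, a ring homomorphism
`ψ : R → ℤ/q` with `2` invertible, `r₁² = 2`, `r₂² = 2 + r₁`, and EULER BITS `B_{jk} ∈ 𝔽₂` with `sym(g_k)^{(q−1)/2} = (−1)^{B_{jk}}`; and a matrix `N`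
over `𝔽₂` with `N·B = 1`.  THEN for every `(e, e', ±) ≠ (0, 0, +)` some character sees `±∏ sym(u_i)^{e_i} sym(w)^{e'}` as a NON-square
(the exponent vector `ε ≠ 0` has `Bε ≠ 0` since `B` is injective; at a row `j` with `(Bε)_j = 1` the product has Euler sign `(−1)^{(Bε)_j} = −1`).
This turns the `2ⁿ⁺² − 1` certificates of `exists_orderOf_eq_four_of_towerOrderFourCert` into `m(n+2)` Euler bits and one matrix identity.
[cite: Serre1973CourseArithmetic, Ch. I §3 (Euler's criterion; the Legendre symbol is a character)]
[cite: Cohen1993, §6.5 (verifying units modulo squares by quadratic characters)] -/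
theorem towerCert_of_charMatrix {R : Type*} [CommRing R] {n m : ℕ} (a₀ a₁ a₂ a₃ : Fin n → R) (A₀ A₁ A₂ A₃ : R)
    (B : Fin m → Fin (n + 2) → ZMod 2) (N : Fin (n + 2) → Fin m → ZMod 2)
    (hNB : ∀ k i, ∑ j, N k j * B j i = if k = i then 1 else 0)
    (hchar : ∀ j : Fin m, ∃ (q : ℕ) (_ : Fact q.Prime) (ψ : R →+* ZMod q) (t r₁ r₂ : ZMod q),
      2 * t = 1 ∧ r₁ ^ 2 = 2 ∧ r₂ ^ 2 = 2 + r₁ ∧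
      (-1 : ZMod q) ^ (q / 2) = (-1) ^ (B j 0).val ∧
      (∀ i : Fin n, (ψ (a₀ i) + ψ (a₁ i) * r₁ + (ψ (a₂ i) + ψ (a₃ i) * r₁) * r₂) ^ (q / 2) =
        (-1) ^ (B j i.castSucc.succ).val) ∧
      (ψ A₀ + ψ A₁ * r₁ + (ψ A₂ + ψ A₃ * r₁) * r₂) ^ (q / 2) = (-1) ^ (B j (Fin.last (n + 1))).val) :
    ∀ (e : Fin n → ℕ) (e' : ℕ) (σ : ℤˣ), (∀ i, e i ≤ 1) → e' ≤ 1 → ¬ (e = 0 ∧ e' = 0 ∧ σ = 1) →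
      ∃ (q : ℕ) (ψ : R →+* ZMod q) (t r₁ r₂ : ZMod q), 2 * t = 1 ∧ r₁ ^ 2 = 2 ∧ r₂ ^ 2 = 2 + r₁ ∧
        ¬ IsSquare (((σ : ℤ) : ZMod q) *
          (∏ i, (ψ (a₀ i) + ψ (a₁ i) * r₁ + (ψ (a₂ i) + ψ (a₃ i) * r₁) * r₂) ^ e i) *
          (ψ A₀ + ψ A₁ * r₁ + (ψ A₂ + ψ A₃ * r₁) * r₂) ^ e') := by
  classical
  intro e e' σ he he' hne
  -- the exponent vector over `𝔽₂`
  set Es : ℕ := if σ = 1 then 0 else 1 with hEs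
  set E : Fin (n + 2) → ℕ := Fin.cons Es (Fin.snoc e e') with hE
  set ε : Fin (n + 2) → ZMod 2 := fun k => (E k : ZMod 2) with hε
  have hE0 : E 0 = Es := by rw [hE, Fin.cons_zero]
  have hEi : ∀ i : Fin n, E i.castSucc.succ = e i := fun i => by rw [hE, Fin.cons_succ, Fin.snoc_castSucc]
  have hEl : E (Fin.last (n + 1)) = e' := by rw [hE, ← Fin.succ_last, Fin.cons_succ, Fin.snoc_last]
  -- `ε ≠ 0`
  have hε0 : ε ≠ 0 := by
    intro h
    apply hne
    have hk : ∀ k, (E k : ZMod 2) = 0 := fun k => congrFun h k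
    refine ⟨?_, ?_, ?_⟩
    · ext i
      have h1 := hk i.castSucc.succ
      rw [hEi] at h1
      have := he i
      interval_cases (e i)
      · rfl
      · exact absurd h1 (by decide)
    · have h1 := hk (Fin.last (n + 1))
      rw [hEl] at h1
      interval_cases e'
      · rfl
      · exact absurd h1 (by decide)
    · have h1 := hk 0
      rw [hE0, hEs] at h1
      by_contra hσ
      rw [if_neg hσ] at h1
      exact absurd h1 (by decide)
  -- some character row sees `ε`
  have hrow : ∃ j, ∑ k, B j k * ε k = 1 := by
    by_contra hall
    have key : ∀ x : ZMod 2, x ≠ 1 → x = 0 := by decide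
    have hall0 : ∀ j, ∑ k, B j k * ε k = 0 := fun j => key _ fun h => hall ⟨j, h⟩
    apply hε0
    ext k
    have : ε k = ∑ i, (if k = i then 1 else 0) * ε i := by
      rw [Finset.sum_eq_single k (fun i _ hik => by rw [if_neg (Ne.symm hik), zero_mul]) (fun h => absurd (Finset.mem_univ k) h),
        if_pos rfl, one_mul]
    rw [this, Pi.zero_apply]
    calc ∑ i, (if k = i then 1 else 0) * ε i = ∑ i, (∑ j, N k j * B j i) * ε i := by
          refine Finset.sum_congr rfl fun i _ => ?_; rw [hNB]
      _ = ∑ j, N k j * ∑ i, B j i * ε i := by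
          simp_rw [Finset.sum_mul, Finset.mul_sum, mul_assoc]
          rw [Finset.sum_comm]
      _ = 0 := by simp_rw [hall0, mul_zero, Finset.sum_const_zero]
  obtain ⟨j, hj⟩ := hrow
  obtain ⟨q, hq, ψ, t, r₁, r₂, ht, hr₁, hr₂, hs, hu, hw⟩ := hchar j
  refine ⟨q, ψ, t, r₁, r₂, ht, hr₁, hr₂, not_isSquare_of_pow_div_two_eq_neg_one ht ?_⟩
  -- Euler sign of the product
  have hσ : ((σ : ℤ) : ZMod q) = (-1) ^ Es := by
    rcases Int.units_eq_one_or σ with rfl | rfl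
    · rw [hEs, if_pos rfl]; simp
    · rw [hEs, if_neg (by decide)]; simp
  set M : ℕ := (B j 0).val * Es + ∑ i, (B j i.castSucc.succ).val * e i + (B j (Fin.last (n + 1))).val * e' with hM
  have hP : (((σ : ℤ) : ZMod q) *
      (∏ i, (ψ (a₀ i) + ψ (a₁ i) * r₁ + (ψ (a₂ i) + ψ (a₃ i) * r₁) * r₂) ^ e i) *
      (ψ A₀ + ψ A₁ * r₁ + (ψ A₂ + ψ A₃ * r₁) * r₂) ^ e') ^ (q / 2) = (-1) ^ M := by
    rw [mul_pow, mul_pow, ← Finset.prod_pow, hσ, pow_pow_div_two_eq hs, pow_pow_div_two_eq hw,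
      Finset.prod_congr rfl fun i _ => pow_pow_div_two_eq (hu i) (e i), Finset.prod_pow_eq_pow_sum, hM, pow_add, pow_add]
  -- `M` is odd
  have hMε : (M : ZMod 2) = ∑ k, B j k * ε k := by
    rw [Fin.sum_univ_succ, Fin.sum_univ_castSucc, hM]
    push_cast
    simp only [ZMod.natCast_val, ZMod.cast_id', id_eq, hε, hE0, hEi, Fin.succ_last, hEl]
    rw [add_assoc]
  rw [hj] at hMε
  have hModd : Odd M := ZMod.natCast_eq_one_iff_odd.mp hMε
  rw [hP, hModd.neg_one_pow]

end CharMatrix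

end Literature.NumberTheory.NumberFields

end
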